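import Summits.BirchSwinnertonDyer.BirchSwinnertonDyer.Theses.TwinTransportX9
import Literature.NumberTheory.EllipticCurves.Rank1Residual.Typed.KolyvaginCertificate
import Literature.NumberTheory.EllipticCurves.MatarNekovar2019.ShaIndexBoundIrreducible
import Literature.NumberTheory.EllipticCurves.Castella2018.TamagawaQuadraticBaseChangeProofs
import Literature.NumberTheory.EllipticCurves.QuadraticTwistRank
import Literature.NumberTheory.EllipticCurves.BSDInvariantsProofs
import Literature.NumberTheory.EllipticCurves.TamagawaFiniteIndexProofs
import Literature.NumberTheory.EllipticCurves.MordellWeilProofs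
import Literature.NumberTheory.QuadraticFields.HeegnerCondition
import Summits.BirchSwinnertonDyer.Rank1Residual.X11b.KrausMinimalityGeneralTwo
import Summits.BirchSwinnertonDyer.Rank1Residual.X11b.ChaPairsMinimality
import Summits.BirchSwinnertonDyer.BirchSwinnertonDyer.Theorems.Rank1ResidualIntModelReduction
import Summits.BirchSwinnertonDyer.Rank1Residual.X9.PrintCertHeegner
import HarnessLib

/-!
# Route `TwinTransportX9` — bc5 WITNESS RUNG of the deciding crux `TrivialTwinSupplyX9` (item 24080) at the
# pair `(648a1, p = 5)`, frame `(d_K, d_F) = (-71, 73)`, twin `W₁ = 648a1^(-71) = [0,0,0,-15123,-5010754]`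

IMPORTABLE (def-free `Theorems/`) landing of the crux workfile `Cruxes/TrivialTwinSupplyX9/Lines/rung_648a1_5.lean`
(crux write 6b64e3ae65da, seat `bsd-trib-w-ttx9` gen 0; same mathematics and displayed binders), so that the route
record's `tribunal_fit.witness` can NAME `TwinTransportX9Rung.rung_648a1_5` (precedent: `RamifiedHeegnerPairRung308025h1`).
`W` = `648a1 = [0,0,0,-3,14]` (`N = 648 = 2³·3⁴`, image `5S4`, `r_an = 1`, `∏ c_ℓ = 2`), `W₁` = its `(-71)`-twist
(`N = 3266568 = 2³·3⁴·71²`, `Δ = -2¹⁰·3⁴·71⁶`). HONEST FRAMING: BSD is NOT proved and nothing is claimed about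
`TrivialTwinSupplyX9` in general (named open in print, Prasanna 2010 p. 400); this is ONE INSTANCE of the crux body,
proved from tree theorems, two PUBLISHED named facts carried as displayed binders (`kolyvagin` = Kolyvagin 1990
Thm. A; `MatarNekovar2019.thm03_padicValNat_card_sha_le_of_irreducible` = Matar–Nekovář 2019 Thm. 0.3, the
Heegner-index bound WITHOUT surjectivity of `ρ̄_{E,5}`) and the ENGINE data of the pair as displayed binders:
`r_an(W₁) = 0`, `L(W₁,1)/Ω(W₁) = 36`, the Heegner point `y_K ∈ E(K)`, `K = ℚ(√-71)`, of infinite order with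
`5 ∤ [E(K) : ℤ y_K]` (`m_K = 6`, `#E(K)_tors = 1`: cell certificate `heegnerCertsS4R1A[0]`, kit j288543 / j287411;
this rung's hash-first preregistered PARI job kit j296627; memo `Cruxes/TrivialTwinSupplyX9/Lines/rung_648a1_5.md`).
DECIDED IN THE KERNEL: ellipticity and global minimality of both equations; the twin identity ON THE NOSE; the
primes of `N(648a1)` are `2, 3`; BCS-admissibility of `(-71, 73)` at `5` (Burungale–Castella–Skinner 2025 §1.2 /
Prop. 5.2.1); the Heegner hypothesis of `ℚ(√-71)`; `5 ∤ #W₁(ℚ)_tors` (irreducibility travels with the twist);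
`ord_5 ∏ c_ℓ(W₁) = ord_5 ∏ c_ℓ(648a1) = 0` (Jetchev–Skinner–Wan 2017 (eq:tamK)); the transport
`Ш(648a1/K)[5] = 0 ⟹ Ш(W₁/ℚ)[5] = 0` (`W₁ ⊗ K ≅ 648a1 ⊗ K`, restriction injective on `5`-torsion). NOT rechecked
in the kernel: `L`-values, periods, heights, the index. WITNESS OF WEAKNESS (T3): `N(W₁) = 3266568 > 5000`, image
`5S4` — outside every verified-BSD₅ regime in the tree (Miller 2011 / Creutz–Miller `N < 5000`; BCS 2025
Thm. 1.1.2 (b) needs (sur)/(im)), so `BSD₅(W₁)` is not known while the instance holds (`¬ 5 ∣ #Ш(W₁)` unconditional).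

References: Matar–Nekovář 2019 Thm. 0.3 [MatarNekovar2019]; Kolyvagin 1990 Thm. A [KolyvaginEulerSystems1990];
Gross 1991 §1–§2 [GrossLMS1991]; Jetchev–Skinner–Wan 2017 §7.3.1 [JetchevSkinnerWan2017]; Burungale–Castella–Skinner
2025 §1.2, Prop. 5.2.1 [BurungaleCastellaSkinner2025]; Prasanna 2010 p. 400 [Prasanna2010]; Silverman AEC VII.1,
VIII.8, X.5 [SilvermanAEC2009]; Cremona's tables [Cremona2006].
-/

set_option linter.dupNamespace false
set_option autoImplicit false

noncomputable section

open scoped Classical NumberField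

open WeierstrassCurve Literature.NumberTheory.EllipticCurves
  Literature.NumberTheory.EllipticCurves.Rank1Residual.X11RankOneCertificates
  Summit.BirchSwinnertonDyer.Rank1Residual.X11b
  Summit.BirchSwinnertonDyer.BirchSwinnertonDyer.Rank1Residual.IntModel
  Summit.BirchSwinnertonDyer.BirchSwinnertonDyer.Rank1Residual
  Summit.BirchSwinnertonDyer.BirchSwinnertonDyer.Theses.TwinTransportX9

namespace Summit.BirchSwinnertonDyer.BirchSwinnertonDyer.Theorems.TwinTransportX9Rung

/-! ## §1 The pair `648a1`, its twin `W₁ = 648a1^(-71)`, minimality, the twin identity -/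

/-- `648a1` is an elliptic curve (`Δ = -82944 ≠ 0`). [cite: Cremona2006, Table 1 (label 648a1)] -/
theorem isElliptic_648a1 : (⟨0, 0, 0, -3, 14⟩ : WeierstrassCurve ℚ).IsElliptic :=
  isElliptic_of_discOf_ne_zero 0 0 0 (-3) 14 (by decide +kernel)

/-- `W₁` is an elliptic curve (`Δ = -10625149949543424 ≠ 0`). [cite: SilvermanAEC2009, III.1] -/
theorem isElliptic_648a1d71 : (⟨0, 0, 0, -15123, -5010754⟩ : WeierstrassCurve ℚ).IsElliptic :=
  isElliptic_of_discOf_ne_zero 0 0 0 (-15123) (-5010754) (by decide +kernel)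

/-- `648a1` is GLOBALLY MINIMAL (`|Δ| = 2¹⁰·3⁴`, no `q¹² ∣ Δ`). [cite: SilvermanAEC2009, VII.1 Remark 1.1] [cite: Kraus1989, Prop. 1 and Prop. 2] -/
theorem isGloballyMinimal_648a1 : (⟨0, 0, 0, -3, 14⟩ : WeierstrassCurve ℚ).IsGloballyMinimal :=
  isGloballyMinimal_of_krausCriterion_support 0 0 0 (-3) 14
    [(2, 3, 10), (3, 4, 4)] (by intro t ht; fin_cases ht <;> norm_num) (by decide +kernel) (by decide +kernel)

/-- `W₁` is GLOBALLY MINIMAL (`|Δ| = 2¹⁰·3⁴·71⁶`, no `q¹² ∣ Δ`). [cite: SilvermanAEC2009, VII.1 Remark 1.1] [cite: Kraus1989, Prop. 1 and Prop. 2] -/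
theorem isGloballyMinimal_648a1d71 : (⟨0, 0, 0, -15123, -5010754⟩ : WeierstrassCurve ℚ).IsGloballyMinimal :=
  isGloballyMinimal_of_krausCriterion_support 0 0 0 (-15123) (-5010754)
    [(2, 3, 10), (3, 4, 4), (71, 2, 6)] (by intro t ht; fin_cases ht <;> norm_num) (by decide +kernel) (by decide +kernel)

/-- The integral model of `648a1` is its Cremona equation. [cite: SilvermanAEC2009, VIII.8] -/
theorem intModel_648a1 :
    haveI := isGloballyMinimal_648a1
    integralModelInt (⟨0, 0, 0, -3, 14⟩ : WeierstrassCurve ℚ) = ⟨0, 0, 0, -3, 14⟩ :=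
  haveI := isGloballyMinimal_648a1
  integralModelInt_eq_of_map_eq _ (map_mk_int 0 0 0 (-3) 14)

/-- **The twin identity ON THE NOSE**: `648a1^(-71) = W₁` (the tree's twist model of
`[0,0,0,a₄,a₆]` by `d` is `[0,0,0,d²a₄,d³a₆]`). [cite: SilvermanAEC2009, X.5 Cor. 5.4 and III.1 Table 3.1] -/
theorem quadraticTwist_648a1 : (⟨0, 0, 0, -3, 14⟩ : WeierstrassCurve ℚ).quadraticTwist (((-71 : ℤ)) : ℚ) = (⟨0, 0, 0, -15123, -5010754⟩ : WeierstrassCurve ℚ) := by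
  ext
  · simp only [quadraticTwist_a₁]
  · simp only [quadraticTwist_a₂, WeierstrassCurve.b₂]; norm_num
  · simp only [quadraticTwist_a₃]
  · simp only [quadraticTwist_a₄, WeierstrassCurve.b₄]; norm_num
  · simp only [quadraticTwist_a₆, WeierstrassCurve.b₆]; norm_num

/-- The twin identity in the crux's shape: `C • W₁ = 648a1^(d_K)` with `C = 1`. [cite: SilvermanAEC2009, X.5 Cor. 5.4] -/
theorem exists_smul_648a1d71 : ∃ C : VariableChange ℚ, C • (⟨0, 0, 0, -15123, -5010754⟩ : WeierstrassCurve ℚ) = (⟨0, 0, 0, -3, 14⟩ : WeierstrassCurve ℚ).quadraticTwist (((-71 : ℤ)) : ℚ) :=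
  ⟨1, by rw [one_smul, quadraticTwist_648a1]⟩

/-! ## §2 The primes of `N(648a1)` and the frame `(d_K, d_F) = (-71, 73)` -/

/-- A prime dividing the conductor of `648a1` is `2` or `3` (good reduction off `Δ = -2¹⁰·3⁴`).
[cite: SilvermanAEC2009, VII.5 Prop. 5.1 (a)] -/
theorem prime_dvd_conductorNorm_648a1 {ℓ : ℕ} (hℓ : ℓ.Prime)
    (h : haveI := isElliptic_648a1; ℓ ∣ (⟨0, 0, 0, -3, 14⟩ : WeierstrassCurve ℚ).conductorNorm ℤ) : ℓ = 2 ∨ ℓ = 3 := by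
  haveI := isElliptic_648a1; haveI := isGloballyMinimal_648a1; haveI := Fact.mk hℓ
  by_contra hne
  push Not at hne
  refine not_dvd_conductorNorm_of_hasGoodReductionAtPrime (⟨0, 0, 0, -3, 14⟩ : WeierstrassCurve ℚ) ?_ h
  refine hasGoodReductionAtPrime_of_not_dvd (⟨0, 0, 0, -3, 14⟩ : WeierstrassCurve ℚ) ℓ ?_
  rw [minimalDiscriminantInt_eq intModel_648a1]
  have hΔ : (⟨0, 0, 0, -3, 14⟩ : WeierstrassCurve ℤ).Δ = -(2 ^ 10 * 3 ^ 4) := by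
    simp only [WeierstrassCurve.Δ, WeierstrassCurve.b₂, WeierstrassCurve.b₄, WeierstrassCurve.b₆,
      WeierstrassCurve.b₈]; norm_num
  rw [hΔ, Int.dvd_neg]
  intro hd
  have hd' : ℓ ∣ 2 ^ 10 * 3 ^ 4 := by exact_mod_cast hd
  rcases (Nat.Prime.dvd_mul hℓ).mp hd' with h2 | h3
  · exact hne.1 ((Nat.prime_dvd_prime_iff_eq hℓ Nat.prime_two).mp (hℓ.dvd_of_dvd_pow h2))
  · exact hne.2 ((Nat.prime_dvd_prime_iff_eq hℓ Nat.prime_three).mp (hℓ.dvd_of_dvd_pow h3))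

/-- **`(d_K, d_F) = (-71, 73)` is BCS-ADMISSIBLE for `(648a1, 5)`**: `-71 < 0` square-free `≡ 1 (4)`,
`≠ -3`; `2, 3` (the primes of `N`) and `5` split in `ℚ(√-71)` (`-71 ≡ 1 (8)`, `-71 ≡ 1 (3)`,
`-71 ≡ 2² (5)`); `73 > 1` square-free `≡ 1 (4)`; `5` inert in `ℚ(√73)` (`73 ≡ 3 (5)`); `73` splits in
`ℚ(√-71)` (`-71 ≡ 32² (73)`); `2, 3 ≢ -1 (5)` split in `ℚ(√73)` (`73 ≡ 1 (8)`, `73 ≡ 1 (3)`); `73 ≠ 5`.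
[cite: BurungaleCastellaSkinner2025, §1.2 (disc)/(Heeg)/(spl), Prop. 5.2.1 (i)–(vi)] -/
theorem bcsAdmissiblePair_648a1 :
    haveI := isElliptic_648a1; haveI := isGloballyMinimal_648a1
    BCSAdmissiblePair (⟨0, 0, 0, -3, 14⟩ : WeierstrassCurve ℚ) 5 (-71) 73 := by
  haveI := isElliptic_648a1; haveI := isGloballyMinimal_648a1
  have h71 : Squarefree ((-71) : ℤ) := by
    rw [← Int.squarefree_natAbs, show ((-71) : ℤ).natAbs = 71 by norm_num]
    exact (by norm_num : Nat.Prime 71).squarefree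
  have h73 : Squarefree ((73) : ℤ) := by
    rw [← Int.squarefree_natAbs, show ((73) : ℤ).natAbs = 73 by norm_num]
    exact (by norm_num : Nat.Prime 73).squarefree
  have hK2 : SplitsInQuadField (-71) 2 := ⟨by decide, fun _ => by decide, fun h => absurd rfl h⟩
  have hK3 : SplitsInQuadField (-71) 3 :=
    ⟨by decide, fun h => absurd h (by decide), fun _ => ⟨1, by decide⟩⟩
  have hK5 : SplitsInQuadField (-71) 5 :=
    ⟨by decide, fun h => absurd h (by decide), fun _ => ⟨2, by decide⟩⟩
  have hK73 : SplitsInQuadField (-71) 73 :=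
    ⟨by decide, fun h => absurd h (by decide), fun _ => ⟨32, by decide⟩⟩
  have hF2 : SplitsInQuadField 73 2 := ⟨by decide, fun _ => by decide, fun h => absurd rfl h⟩
  have hF3 : SplitsInQuadField 73 3 :=
    ⟨by decide, fun h => absurd h (by decide), fun _ => ⟨1, by decide⟩⟩
  have hF5 : InertInQuadField 73 5 :=
    ⟨by decide, fun h => absurd h (by decide), fun _ => by decide⟩
  refine ⟨⟨by norm_num, h71, by decide, by decide⟩, ?_, hK5, ⟨by norm_num, h73, by decide⟩, hF5, ?_, ?_,
    fun _ => by decide⟩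
  · intro ℓ hℓ hℓN
    rcases prime_dvd_conductorNorm_648a1 hℓ hℓN with rfl | rfl
    exacts [hK2, hK3]
  · intro ℓ hℓ hℓd
    have h' : ℓ ∣ 73 := by exact_mod_cast Int.natAbs_dvd_natAbs.mpr hℓd
    have : ℓ = 73 := (Nat.prime_dvd_prime_iff_eq hℓ (by norm_num)).mp h'
    subst this; exact hK73
  · intro ℓ hℓ hℓN
    rcases prime_dvd_conductorNorm_648a1 hℓ hℓN with rfl | rfl
    · exact ⟨fun h => absurd h (by decide), fun _ => hF2⟩
    · exact ⟨fun h => absurd h (by decide), fun _ => hF3⟩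

/-! ## §3 `Ш` of a quadratic twist at a prime not dividing the Heegner index (irreducible image) -/

section Transport

variable {K : Type} [Field K] [NumberField K]

/-- `√d_K ∈ K ∖ ℚ` with `(√d_K)² = d_K` when `d_K < 0` (Marcus, *Number Fields*, Ch. 2 Thm. 1). [folklore] -/
theorem exists_sqrt_discr (h2 : Module.finrank ℚ K = 2) {d : ℤ} (hdK : NumberField.discr K = d)
    (hd : d < 0) : ∃ θ : K, θ ∉ Set.range (algebraMap ℚ K) ∧ θ ^ 2 = algebraMap ℚ K (d : ℚ) := by
  obtain ⟨-, -, δ, -, hδ⟩ :=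
    Literature.NumberTheory.QuadraticFields.Quadratic.exists_sq_eq_discr (K := K) h2
  have hθ2 : ((δ : K)) ^ 2 = algebraMap ℚ K (d : ℚ) := by
    have h := congrArg (algebraMap (𝓞 K) K) hδ
    rw [map_pow, hdK] at h
    rw [h, map_intCast]
    exact (map_intCast (algebraMap ℚ K) d).symm
  refine ⟨(δ : K), ?_, hθ2⟩
  rintro ⟨r, hr⟩
  have h1 : algebraMap ℚ K (r ^ 2) = algebraMap ℚ K (d : ℚ) := by rw [map_pow, hr, hθ2]
  have h2' : r ^ 2 = (d : ℚ) := (algebraMap ℚ K).injective h1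
  have : (0 : ℚ) ≤ (d : ℚ) := h2' ▸ sq_nonneg r
  exact absurd (by exact_mod_cast this : (0 : ℤ) ≤ d) (not_le.mpr hd)

/-- **`Ш(E^{(c)} ⊗ K) ≅ Ш(E ⊗ K)` numerically** for `K ∋ √c`: `#Ш((W^{(c)})_K) = #Ш(W_K)` (`Nat.card`),
since `W^{(c)} ⊗ K ≅ W ⊗ K` by `u = √c` (Silverman, *AEC*, X.5 Cor. 5.4) and `#Ш` is invariant under
changes of variables. [cite: SilvermanAEC2009, X.5 Cor. 5.4] -/
theorem card_sha_baseChange_quadraticTwist_eq (V : WeierstrassCurve ℚ) {θ : K} {c : ℚ}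
    (hθ : θ ∉ Set.range (algebraMap ℚ K)) (hc : θ ^ 2 = algebraMap ℚ K c) :
    Nat.card ((V.quadraticTwist c).baseChange K).sha = Nat.card (V.baseChange K).sha := by
  have h1 : twistUntwist hθ • (V.quadraticTwist c).baseChange K = (V.quadraticTwist 1).baseChange K :=
    twistUntwist_smul_baseChange V hθ hc
  obtain ⟨C₁, hC₁⟩ := V.exists_variableChange_quadraticTwist_one
  have h2 : (V.quadraticTwist 1).baseChange K = C₁.baseChange K • V.baseChange K := by
    rw [← hC₁, baseChange_smul_eq]
  calc Nat.card ((V.quadraticTwist c).baseChange K).sha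
      = ((V.quadraticTwist c).baseChange K).shaOrder := rfl
    _ = (twistUntwist hθ • (V.quadraticTwist c).baseChange K).shaOrder :=
        ((shaOrder_variableChange_holds _ _ : shaOrder_variableChange _ _)).symm
    _ = (C₁.baseChange K • V.baseChange K).shaOrder := by rw [h1, h2]
    _ = (V.baseChange K).shaOrder := (shaOrder_variableChange_holds _ _ : shaOrder_variableChange _ _)
    _ = Nat.card (V.baseChange K).sha := rfl

/-- **`Ш(E^{(d_K)}/ℚ)[p] = 0` from a Heegner point of index prime to `p`, IRREDUCIBLE image.** For `E/ℚ` (model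
`V`), `K` imaginary quadratic, `d_K < 0`, `d_K ≠ -3, -4`, Heegner for `N`, `P ∈ E(K)` a Heegner point of infinite
order with `p ∤ [E(K) : ℤP]`, `p` odd, `ρ̄_{E,p}` irreducible: Kolyvagin (`kolyvagin`) gives `Ш(E/K)` finite,
Matar–Nekovář Thm. 0.3 gives `p ∤ #Ш(E/K)`; as `E^{(d_K)} ⊗ K ≅ E ⊗ K`, `Ш(E^{(d_K)} ⊗ K)` is finite of order
prime to `p`, so `Ш(E^{(d_K)}/ℚ)` is finite and (restriction injective on `p`-torsion, `p ∤ [K:ℚ]`) `p ∤ #Ш(E^{(d_K)}/ℚ)`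
— Gross 1991 Prop. 2.1/2.3 run for the twin. [cite: GrossLMS1991, §2 Prop. 2.1 (2) and Prop. 2.3]
[cite: MatarNekovar2019, Thm. 0.3 (p. 456)] [cite: KolyvaginEulerSystems1990, Thm. A] [cite: SerreGaloisCohomology1997, I.§2.4 Cor. to Prop. 9] -/
theorem shaFinite_and_not_dvd_shaOrder_twist_of_mn03 {N : ℕ} [NeZero N] (V : WeierstrassCurve ℚ)
    [V.IsElliptic] (hK : IsImaginaryQuadratic K) {d : ℤ} (hdK : NumberField.discr K = d) (hd : d < 0)
    (hD3 : d ≠ -3) (hD4 : d ≠ -4) (hH : SatisfiesHeegnerHypothesis N K) (hKo : kolyvagin N V K)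
    (hMN : MatarNekovar2019.thm03_padicValNat_card_sha_le_of_irreducible N V K)
    {P : (V.baseChange K).toAffine.Point} (hP : IsHeegnerPoint N V K P) (hnt : ¬ IsOfFinAddOrder P)
    {p : ℕ} [Fact p.Prime] (hp2 : p ≠ 2) (hirr : V.HasIrreducibleModPGaloisRep p)
    (hI : ¬ p ∣ (AddSubgroup.zmultiples P).index)
    (V₁ : WeierstrassCurve ℚ) [V₁.IsElliptic] (hV₁ : V.quadraticTwist (d : ℚ) = V₁) :
    V₁.ShaFinite ∧ ¬ p ∣ V₁.shaOrder := by
  have hp : p.Prime := Fact.out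
  obtain ⟨-, hfinK⟩ := hKo hK hH hP hnt
  have h0 : padicValNat p (Nat.card (V.baseChange K).sha) = 0 :=
    MatarNekovar2019.padicValNat_card_sha_eq_zero_of_not_dvd_index_of_irreducible hMN hK hH
      (by rw [hdK]; exact hD3) (by rw [hdK]; exact hD4) hP hnt hp hp2 hirr hI
  haveI : Finite (V.baseChange K).sha := hfinK
  have hndvdK : ¬ p ∣ Nat.card (V.baseChange K).sha := by
    rcases padicValNat.eq_zero_iff.mp h0 with h1 | h0' | hnd
    · exact absurd h1 hp.one_lt.ne'
    · exact absurd h0' Nat.card_pos.ne'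
    · exact hnd
  -- transport over `K` to the twin
  obtain ⟨θ, hθ, hθ2⟩ := exists_sqrt_discr hK.1 hdK hd
  have hcard : Nat.card (V₁.baseChange K).sha = Nat.card (V.baseChange K).sha := by
    subst hV₁; exact card_sha_baseChange_quadraticTwist_eq V hθ hθ2
  haveI hfin₁ : Finite (V₁.baseChange K).sha :=
    Nat.finite_of_card_ne_zero (by rw [hcard]; exact Nat.card_pos.ne')
  have hndvd : ¬ p ∣ Nat.card (V₁.baseChange K).sha := by rw [hcard]; exact hndvdK
  haveI : IsGalois ℚ K := by
    haveI : Algebra.IsQuadraticExtension ℚ K := ⟨hK.1⟩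
    infer_instance
  have hcop : p.Coprime (Module.finrank ℚ K) := by
    rw [hK.1]
    exact (Nat.coprime_primes hp Nat.prime_two).mpr hp2
  have hnoP : ∀ x : V₁.sha, (p : ℤ) • x = 0 → x = 0 := by
    intro x hx
    have hxn : p • x = 0 := by rw [← natCast_zsmul]; exact hx
    have hres : shaRestriction V₁ K x = 0 := by
      have hpr : p • shaRestriction V₁ K x = 0 := by rw [← map_nsmul, hxn, map_zero]
      have hdiv : addOrderOf (shaRestriction V₁ K x) ∣ p := addOrderOf_dvd_of_nsmul_eq_zero hpr
      rcases (Nat.dvd_prime hp).mp hdiv with h1 | hp'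
      · exact AddMonoid.addOrderOf_eq_one_iff.mp h1
      · exact absurd (hp' ▸ addOrderOf_dvd_natCard (shaRestriction V₁ K x)) hndvd
    have hx_mem : x ∈ (AddSubgroup.torsionBy V₁.sha p : Set V₁.sha) :=
      AddSubgroup.torsionBy.nsmul_iff.mpr hxn
    have h0_mem : (0 : V₁.sha) ∈ (AddSubgroup.torsionBy V₁.sha p : Set V₁.sha) :=
      AddSubgroup.torsionBy.nsmul_iff.mpr (smul_zero _)
    exact injOn_shaRestriction_torsionBy V₁ K hcop hx_mem h0_mem (by rw [hres, map_zero])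
  have hfinQ : V₁.ShaFinite := shaFinite_of_baseChange V₁ K hfin₁
  refine ⟨hfinQ, ?_⟩
  have hv := Rank1Residual.Typed.padicValNat_shaOrder_eq_zero_of_noPTorsion V₁ p hfinQ hnoP
  rcases padicValNat.eq_zero_iff.mp hv with h1 | h0' | hnd
  · exact absurd h1 hp.one_lt.ne'
  · exact absurd h0' (shaOrder_pos V₁ hfinQ).ne'
  · exact hnd

end Transport

/-! ## §4 The Heegner field `ℚ(√-71)` for `648a1` -/

section HeegnerField

variable {K : Type} [Field K] [NumberField K]

/-- `2` splits in a quadratic field of discriminant `-71` (`-71 ≡ 1 (mod 8)`). [cite: Marcus1977, Ch. 3 Thm. 25] -/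
theorem two_splits_neg71 (hK2 : Module.finrank ℚ K = 2) (hdK : NumberField.discr K = -71) :
    ((Ideal.span {((2 : ℕ) : ℤ)}).primesOver (𝓞 K)).ncard = 2 :=
  Summit.BirchSwinnertonDyer.Rank1Residual.X9.PrintCert.Record.ncard_primesOver_two_eq_two_of_mod_eight hK2 (by rw [hdK]; decide)

/-- `3` splits in a quadratic field of discriminant `-71` (`-71 ≡ 1² (mod 3)`). [cite: Marcus1977, Ch. 3 Thm. 25] -/
theorem three_splits_neg71 (hK2 : Module.finrank ℚ K = 2) (hdK : NumberField.discr K = -71) :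
    ((Ideal.span {((3 : ℕ) : ℤ)}).primesOver (𝓞 K)).ncard = 2 :=
  Summit.BirchSwinnertonDyer.Rank1Residual.X9.PrintCert.Record.ncard_primesOver_eq_two_of_witness hK2 Nat.prime_three (by decide) (s := 1)
    (by rw [hdK]; decide) (by rw [hdK]; decide)

/-- **Heegner hypothesis of `ℚ(√-71)` for the level `648 = 2³·3⁴`.** [cite: GrossLMS1991, §1] -/
theorem satisfiesHeegnerHypothesis_648 (hK2 : Module.finrank ℚ K = 2) (hdK : NumberField.discr K = -71) :
    SatisfiesHeegnerHypothesis 648 K := by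
  intro ℓ hℓ hℓN
  have hℓN' : ℓ ∣ 2 ^ 3 * 3 ^ 4 := by norm_num at hℓN ⊢; exact hℓN
  rcases (Nat.Prime.dvd_mul hℓ).mp hℓN' with h2 | h3
  · obtain rfl := (Nat.prime_dvd_prime_iff_eq hℓ Nat.prime_two).mp (hℓ.dvd_of_dvd_pow h2)
    exact two_splits_neg71 hK2 hdK
  · obtain rfl := (Nat.prime_dvd_prime_iff_eq hℓ Nat.prime_three).mp (hℓ.dvd_of_dvd_pow h3)
    exact three_splits_neg71 hK2 hdK

/-- **Heegner hypothesis of `ℚ(√-71)` for the conductor of `648a1`** (its primes are `2, 3`). [cite: GrossLMS1991, §1] -/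
theorem satisfiesHeegnerHypothesis_conductorNorm_648a1 (hK2 : Module.finrank ℚ K = 2)
    (hdK : NumberField.discr K = -71) :
    haveI := isElliptic_648a1
    SatisfiesHeegnerHypothesis ((⟨0, 0, 0, -3, 14⟩ : WeierstrassCurve ℚ).conductorNorm ℤ) K := by
  intro ℓ hℓ hℓN
  rcases prime_dvd_conductorNorm_648a1 hℓ hℓN with rfl | rfl
  exacts [two_splits_neg71 hK2 hdK, three_splits_neg71 hK2 hdK]

end HeegnerField

/-! ## §5 The rung: the crux body at `(648a1, 5)` -/

/-- `ord_p n = 0` and `n > 0` give `p ∤ n`. [folklore] -/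
theorem not_dvd_of_padicValNat_eq_zero {p n : ℕ} (hp : p.Prime) (hn : 0 < n) (h : padicValNat p n = 0) : ¬ p ∣ n := by
  rcases padicValNat.eq_zero_iff.mp h with h1 | h0 | hnd
  exacts [absurd h1 hp.one_lt.ne', absurd h0 hn.ne', hnd]

/-- `-71` is square-free. [folklore] -/
theorem squarefree_neg71 : Squarefree ((-71) : ℤ) := by
  rw [← Int.squarefree_natAbs, show ((-71) : ℤ).natAbs = 71 by norm_num]
  exact (by norm_num : Nat.Prime 71).squarefree

/-- The rung's statement IS the instance of the crux: `TrivialTwinSupplyX9` specialises VERBATIM to the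
crux body at `(W, p) = (648a1, 5)` (bound variables renamed). [cite: BurungaleCastellaSkinner2025, §1.2 and Prop. 5.2.1] -/
theorem rung_isInstance_648a1_5 (h : TrivialTwinSupplyX9) :
    haveI := isElliptic_648a1; haveI := isGloballyMinimal_648a1; haveI : Fact (Nat.Prime 5) := ⟨by norm_num⟩
    ClassX9 (⟨0, 0, 0, -3, 14⟩ : WeierstrassCurve ℚ) 5 → ¬ 5 ∣ (⟨0, 0, 0, -3, 14⟩ : WeierstrassCurve ℚ).tamagawaProduct → ∃ dK dF : ℤ, BCSAdmissiblePair (⟨0, 0, 0, -3, 14⟩ : WeierstrassCurve ℚ) 5 dK dF ∧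
      ∃ (V₁ : WeierstrassCurve ℚ) (_ : V₁.IsElliptic) (_ : V₁.IsGloballyMinimal),
        (∃ C : WeierstrassCurve.VariableChange ℚ, C • V₁ = (⟨0, 0, 0, -3, 14⟩ : WeierstrassCurve ℚ).quadraticTwist (dK : ℚ)) ∧
        ((V₁.analyticRank = 0 ∧ ¬ 5 ∣ V₁.shaOrder ∧ ¬ 5 ∣ V₁.tamagawaProduct ∧ ¬ 5 ∣ V₁.torsionOrder ∧
            ∃ q : ℚ, V₁.leadingLCoeff / (V₁.realPeriodRat : ℂ) = (q : ℂ) ∧ padicValRat 5 q = 0) ∨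
          ∃ dK' dF' : ℤ, BCSAdmissiblePair V₁ 5 dK' dF' ∧
            ∃ (V₂ : WeierstrassCurve ℚ) (_ : V₂.IsElliptic) (_ : V₂.IsGloballyMinimal),
              (∃ C : WeierstrassCurve.VariableChange ℚ, C • V₂ = V₁.quadraticTwist (dK' : ℚ)) ∧
              (V₂.analyticRank = 0 ∧ ¬ 5 ∣ V₂.shaOrder ∧ ¬ 5 ∣ V₂.tamagawaProduct ∧ ¬ 5 ∣ V₂.torsionOrder ∧
                ∃ q : ℚ, V₂.leadingLCoeff / (V₂.realPeriodRat : ℂ) = (q : ℂ) ∧ padicValRat 5 q = 0)) :=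
  @h (⟨0, 0, 0, -3, 14⟩ : WeierstrassCurve ℚ) isElliptic_648a1 isGloballyMinimal_648a1 5 ⟨by norm_num⟩

/-- **THE RUNG.** The crux body at `(648a1, 5)`, witnessed by the frame `(d_K, d_F) = (-71, 73)` and the
twin `W₁ = 648a1^(-71)` (first disjunct: the twin is BSD₅-trivial in every factor except `#Ш`, and
`5 ∤ #Ш(W₁)` by Kolyvagin + Matar–Nekovář transported along `W₁ ⊗ K ≅ 648a1 ⊗ K`, `K = ℚ(√-71)`).
Displayed binders: the two PUBLISHED named facts (`kolyvagin`, Matar–Nekovář Thm. 0.3) and the ENGINE data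
of the pair (`r_an(W₁) = 0`, `L(W₁,1)/Ω(W₁) = 36`, the Heegner point `y_K` of infinite order with
`5 ∤ [E(K) : ℤ y_K]`; preregistered kit PARI job j296627, memo `Cruxes/TrivialTwinSupplyX9/Lines/rung_648a1_5.md`). BSD is NOT proved.
[cite: MatarNekovar2019, Thm. 0.3 (p. 456)] [cite: KolyvaginEulerSystems1990, Thm. A]
[cite: GrossLMS1991, §2 Prop. 2.1 (2), Prop. 2.3] [cite: JetchevSkinnerWan2017, §7.3.1 (eq:tamK)]
[cite: BurungaleCastellaSkinner2025, §1.2, Prop. 5.2.1] -/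
theorem rung_648a1_5 {K : Type} [Field K] [NumberField K] (hK : IsImaginaryQuadratic K)
    (hdK : NumberField.discr K = -71) (hKo : kolyvagin 648 (⟨0, 0, 0, -3, 14⟩ : WeierstrassCurve ℚ) K)
    (hMN : MatarNekovar2019.thm03_padicValNat_card_sha_le_of_irreducible 648 (⟨0, 0, 0, -3, 14⟩ : WeierstrassCurve ℚ) K)
    {P : ((⟨0, 0, 0, -3, 14⟩ : WeierstrassCurve ℚ).baseChange K).toAffine.Point} (hP : IsHeegnerPoint 648 (⟨0, 0, 0, -3, 14⟩ : WeierstrassCurve ℚ) K P) (hnt : ¬ IsOfFinAddOrder P)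
    (hI : ¬ 5 ∣ (AddSubgroup.zmultiples P).index) (hr₁ : (⟨0, 0, 0, -15123, -5010754⟩ : WeierstrassCurve ℚ).analyticRank = 0)
    (hL₁ : (⟨0, 0, 0, -15123, -5010754⟩ : WeierstrassCurve ℚ).leadingLCoeff / ((⟨0, 0, 0, -15123, -5010754⟩ : WeierstrassCurve ℚ).realPeriodRat : ℂ) = ((36 : ℚ) : ℂ)) :
    haveI := isElliptic_648a1; haveI := isGloballyMinimal_648a1; haveI : Fact (Nat.Prime 5) := ⟨by norm_num⟩
    ClassX9 (⟨0, 0, 0, -3, 14⟩ : WeierstrassCurve ℚ) 5 → ¬ 5 ∣ (⟨0, 0, 0, -3, 14⟩ : WeierstrassCurve ℚ).tamagawaProduct → ∃ dK dF : ℤ, BCSAdmissiblePair (⟨0, 0, 0, -3, 14⟩ : WeierstrassCurve ℚ) 5 dK dF ∧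
      ∃ (V₁ : WeierstrassCurve ℚ) (_ : V₁.IsElliptic) (_ : V₁.IsGloballyMinimal),
        (∃ C : WeierstrassCurve.VariableChange ℚ, C • V₁ = (⟨0, 0, 0, -3, 14⟩ : WeierstrassCurve ℚ).quadraticTwist (dK : ℚ)) ∧
        ((V₁.analyticRank = 0 ∧ ¬ 5 ∣ V₁.shaOrder ∧ ¬ 5 ∣ V₁.tamagawaProduct ∧ ¬ 5 ∣ V₁.torsionOrder ∧
            ∃ q : ℚ, V₁.leadingLCoeff / (V₁.realPeriodRat : ℂ) = (q : ℂ) ∧ padicValRat 5 q = 0) ∨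
          ∃ dK' dF' : ℤ, BCSAdmissiblePair V₁ 5 dK' dF' ∧
            ∃ (V₂ : WeierstrassCurve ℚ) (_ : V₂.IsElliptic) (_ : V₂.IsGloballyMinimal),
              (∃ C : WeierstrassCurve.VariableChange ℚ, C • V₂ = V₁.quadraticTwist (dK' : ℚ)) ∧
              (V₂.analyticRank = 0 ∧ ¬ 5 ∣ V₂.shaOrder ∧ ¬ 5 ∣ V₂.tamagawaProduct ∧ ¬ 5 ∣ V₂.torsionOrder ∧
                ∃ q : ℚ, V₂.leadingLCoeff / (V₂.realPeriodRat : ℂ) = (q : ℂ) ∧ padicValRat 5 q = 0)) := by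
  haveI := isElliptic_648a1; haveI := isGloballyMinimal_648a1
  haveI := isElliptic_648a1d71; haveI := isGloballyMinimal_648a1d71
  haveI i5 : Fact (Nat.Prime 5) := ⟨by norm_num⟩
  haveI : NeZero (648 : ℕ) := ⟨by norm_num⟩
  intro hX9 hTam
  have hirr : (⟨0, 0, 0, -3, 14⟩ : WeierstrassCurve ℚ).HasIrreducibleModPGaloisRep 5 := hX9.2.2.2.2.1
  -- `Ш(W₁)`: Kolyvagin + Matar–Nekovář over `K`, transported to the twin
  have hsha : ¬ 5 ∣ (⟨0, 0, 0, -15123, -5010754⟩ : WeierstrassCurve ℚ).shaOrder :=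
    (shaFinite_and_not_dvd_shaOrder_twist_of_mn03 (⟨0, 0, 0, -3, 14⟩ : WeierstrassCurve ℚ) hK hdK (by norm_num) (by norm_num) (by norm_num)
      (satisfiesHeegnerHypothesis_648 hK.1 hdK) hKo hMN hP hnt (by norm_num) hirr hI (⟨0, 0, 0, -15123, -5010754⟩ : WeierstrassCurve ℚ) quadraticTwist_648a1).2
  -- `∏ c_ℓ(W₁)`: Jetchev–Skinner–Wan (eq:tamK), all bad primes of `648a1` split in `K`
  have htamv : padicValNat 5 (⟨0, 0, 0, -15123, -5010754⟩ : WeierstrassCurve ℚ).tamagawaProduct = padicValNat 5 (⟨0, 0, 0, -3, 14⟩ : WeierstrassCurve ℚ).tamagawaProduct :=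
    Castella2018.TamagawaQuadratic.padicValNat_tamagawaProduct_quadraticTwist_eq (⟨0, 0, 0, -3, 14⟩ : WeierstrassCurve ℚ) 5 K (⟨0, 0, 0, -15123, -5010754⟩ : WeierstrassCurve ℚ) le_rfl hK.1
      (fun ℓ _ hℓN hns => absurd (satisfiesHeegnerHypothesis_conductorNorm_648a1 hK.1 hdK ℓ Fact.out hℓN) hns)
      ⟨1, by rw [one_smul, hdK]; exact quadraticTwist_648a1⟩
  have htam : ¬ 5 ∣ (⟨0, 0, 0, -15123, -5010754⟩ : WeierstrassCurve ℚ).tamagawaProduct :=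
    not_dvd_of_padicValNat_eq_zero i5.out (⟨0, 0, 0, -15123, -5010754⟩ : WeierstrassCurve ℚ).tamagawaProduct_pos'
      (htamv.trans (padicValNat.eq_zero_of_not_dvd hTam))
  -- `#W₁(ℚ)_tors`: `ρ̄_{W₁,5} ≅ ρ̄_{648a1,5} ⊗ χ` is irreducible
  have hX9₁ : ClassX9 (⟨0, 0, 0, -15123, -5010754⟩ : WeierstrassCurve ℚ) 5 :=
    Summit.BirchSwinnertonDyer.Rank1Residual.X9.classX9_of_smul_eq_quadraticTwist (⟨0, 0, 0, -3, 14⟩ : WeierstrassCurve ℚ) (⟨0, 0, 0, -15123, -5010754⟩ : WeierstrassCurve ℚ) 5 hX9 squarefree_neg71 (C := 1)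
      (by rw [one_smul]; exact quadraticTwist_648a1.symm) (by decide)
  have htors : ¬ 5 ∣ (⟨0, 0, 0, -15123, -5010754⟩ : WeierstrassCurve ℚ).torsionOrder :=
    not_dvd_of_padicValNat_eq_zero i5.out (⟨0, 0, 0, -15123, -5010754⟩ : WeierstrassCurve ℚ).torsionOrder_pos_holds
      (Rank1Residual.padicValNat_torsionOrder_eq_zero_of_irreducible (⟨0, 0, 0, -15123, -5010754⟩ : WeierstrassCurve ℚ) 5 hX9₁.2.2.2.2.1)
  have h36 : padicValRat 5 (36 : ℚ) = 0 := by
    rw [show ((36 : ℚ)) = ((36 : ℕ) : ℚ) by norm_num, padicValRat.of_nat, Nat.cast_eq_zero]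
    exact padicValNat.eq_zero_of_not_dvd (by norm_num)
  exact ⟨-71, 73, bcsAdmissiblePair_648a1, (⟨0, 0, 0, -15123, -5010754⟩ : WeierstrassCurve ℚ), isElliptic_648a1d71, isGloballyMinimal_648a1d71, exists_smul_648a1d71,
    Or.inl ⟨hr₁, hsha, htam, htors, 36, hL₁, h36⟩⟩

end Summit.BirchSwinnertonDyer.BirchSwinnertonDyer.Theorems.TwinTransportX9Rung

end
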